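import Mathlib.Algebra.Module.PID
import Mathlib.Algebra.Polynomial.Module.FiniteDimensional
import Mathlib.RingTheory.AdjoinRoot
import Mathlib.LinearAlgebra.Dimension.Constructions
import Mathlib.LinearAlgebra.Matrix.Rank
import Mathlib.LinearAlgebra.Matrix.ToLin
import Mathlib.LinearAlgebra.Matrix.GeneralLinearGroup.Defs
import Mathlib.Algebra.Ring.Aut
import Mathlib.FieldTheory.Galois.Basic
import Literature.RingTheory.GaloisAlgebras.HilbertNinetyAlgebras
import HarnessLib

/-!
# Galois-stable similarity classes of matrices contain rational matrices

Let `E` be a field of characteristic `0`, `σ` an automorphism of `E` of finite order `ℓ`, and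
`U ∈ M_n(E)` a square matrix which is conjugate to its entrywise image under `σ`:
`U^σ = x⁻¹ U x` for some `x ∈ GL_n(E)`. Then

* `exists_units_conj_map_eq_self`: some conjugate `g⁻¹ U g` (`g ∈ GL_n(E)`) is fixed by `σ`;
* `exists_units_conj_eq_map_algebraMap` (`…_units` for invertible `U`): if `E / F` is a finite
  Galois extension with `Gal(E/F) = ⟨σ⟩`, then `U` is `GL_n(E)`-conjugate to a matrix with
  entries in `F` — **a Galois-stable similarity class has a rational point**.

This is the linear algebra behind the existence half of Arthur–Clozel, *Simple algebras, base
change, and the advanced theory of the trace formula* (1989), Ch. 1, Lemma 1.1 (i) (the norm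
`N x = x x^σ ⋯ x^{σ^{ℓ-1}}` of `x ∈ GL_n(E)` is `GL_n(E)`-conjugate to an element of `GL_n(F)`;
see `Literature.NumberTheory.Automorphic.ArthurClozelNormMapRational`), which Arthur–Clozel and
Langlands (*Base change for `GL(2)`*, §4) read off the elementary divisors: the invariant
factors of `U` are `σ`-stable, hence rational, and `U` is conjugate to their rational canonical
form (Jacobson, *Basic Algebra I*, §3.10; Hungerford, *Algebra*, VII.4). Mathlib has the
existence half of the structure theorem over a PID (`Module.equiv_directSum_of_isTorsion`) but
neither its uniqueness half nor the rational canonical form; the proof below replaces them by a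
count of elementary divisors and Hilbert's Theorem 90.

## The proof

1. *Cyclic modules* (`finrank_torsionBy_quotient_span_pow`, `…_irreducible_pow`): the
   `q^k`-torsion of `E[X]/(p^e)` (`p, q` irreducible) has `E`-dimension `min(k,e) · deg q` if
   `q ∼ p` and `0` otherwise; hence (`natDegree_mul_card_filter_add_finrank_torsionBy`) in
   `M = ⨁ⱼ E[X]/(pⱼ^{eⱼ})` the numbers `#{j : q ∼ pⱼ, eⱼ ≥ k}` are determined by the dimensions
   `dim_E M[q^k]` — the uniqueness of the elementary divisors in the form needed here.
2. *Invariance* (`finrank_ker_aeval_map_eq`): `dim ker b(U) = dim ker b^σ(U)` when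
   `U^σ = x⁻¹ U x` (`b(U)^σ = b^σ(U^σ) = x⁻¹ b^σ(U) x`, and ranks are invariant under `σ` and under
   conjugation); so (`card_filter_associated_eq_of_map_eq_conj`, `card_filter_label_eq`) the
   multiset of elementary divisors `(pⱼ, eⱼ)` of `(Eⁿ, U)` is stable under `p ↦ p^σ`.
3. *Relabelling* (`exists_iterate_eq_of_card_fibre_eq`, combinatorics): there is a self-map `π`
   of the index set with `(p_{πj}, e_{πj}) = (pⱼ^σ, eⱼ)` up to units and `π^ℓ = id`; it carries
   (`exists_addMonoidEnd_directSum_relabel`) a `σ`-semilinear additive self-map `Ψ` of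
   `⨁ⱼ E[X]/(pⱼ^{eⱼ})`, `f mod pⱼ^{eⱼ} ↦ f^σ mod p_{πj}^{e_{πj}}`, with `Ψ^ℓ = 1`.
4. *Descent datum* (`exists_mul_map_eq_mul_and_prod_eq_one`): transported to `Eⁿ` through
   `(Eⁿ, U) ≅ ⨁ⱼ E[X]/(pⱼ^{eⱼ})` (`Module.AEval'`), `Ψ` becomes `v ↦ y v^σ` with `y ∈ M_n(E)`,
   `y U^σ = U y` (`Ψ` is `E[X]`-semilinear, i.e. commutes with `U`) and
   `y y^σ ⋯ y^{σ^{ℓ-1}} = 1` (`Ψ^ℓ = 1`).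
5. *Hilbert 90* (`exists_units_conj_map_eq_self`): by
   `Literature.RingTheory.GaloisAlgebras.hilbert90_cyclic_of_charZero` for the algebra `M_n(E)`
   there is `b ∈ GL_n(E)` with `y b^σ = b`, and then `(b⁻¹ U b)^σ = b⁻¹ U b`; a `σ`-fixed matrix
   has entries in `E^{⟨σ⟩} = F` (`IsGalois.mem_range_algebraMap_iff_fixed`).

Theorems only (no definitions, no named facts). Companion of
`Literature.LinearAlgebra.Matrix.SimilarityDescent` (similarity descends to an infinite subfield).

## References

* J. Arthur, L. Clozel, *Simple algebras, base change, and the advanced theory of the trace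
  formula*, Ann. of Math. Stud. 120 (1989), Ch. 1, §1, Lemma 1.1 [ArthurClozelAMS120].
* R. P. Langlands, *Base change for `GL(2)`*, Ann. of Math. Stud. 96 (1980), §4.
* N. Jacobson, *Basic Algebra I*, 2nd ed. (1985), §3.10 (rational canonical form);
  T. W. Hungerford, *Algebra*, GTM 73, VII.4 (elementary divisors).
* J.-P. Serre, *Local Fields*, GTM 67, Ch. X, §1 (Hilbert 90, Galois descent).
-/

open Polynomial Submodule Finset
open scoped DirectSum MatrixGroups Matrix

namespace Literature.LinearAlgebra.Matrix

section Cyclic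

variable {E : Type*} [Field E]

/-- If `a` and `b` are coprime, `a`-torsion in `E[X] ⧸ (b)` is trivial. [folklore] -/
theorem torsionBy_quotient_span_eq_bot_of_isCoprime {a b : E[X]} (hab : IsCoprime a b) :
    torsionBy E[X] (E[X] ⧸ Ideal.span {b}) a = ⊥ := by
  rw [eq_bot_iff]
  intro m hm
  rw [mem_torsionBy_iff] at hm
  obtain ⟨f, rfl⟩ := Submodule.Quotient.mk_surjective _ m
  obtain ⟨c, d, hcd⟩ := hab
  rw [Submodule.mem_bot]
  have : (Submodule.Quotient.mk f : E[X] ⧸ Ideal.span {b}) =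
      c • (a • Submodule.Quotient.mk f) + Submodule.Quotient.mk (d * b * f) := by
    rw [smul_smul, ← Submodule.Quotient.mk_smul, ← Submodule.Quotient.mk_add, smul_eq_mul,
      ← add_mul, hcd, one_mul]
  rw [this, hm, smul_zero, zero_add, Submodule.Quotient.mk_eq_zero]
  exact Ideal.mem_span_singleton.mpr ⟨d * f, by ring⟩

/-- In `E[X] ⧸ (c d)` (`c ≠ 0`), the `d`-torsion is the image of `r ↦ r c`, with kernel `(d)`:
so it is isomorphic to `E[X] ⧸ (d)` and has `E`-dimension `deg d`. [folklore] -/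
theorem finrank_torsionBy_quotient_span_mul {c d : E[X]} (hc : c ≠ 0) (hd : d ≠ 0) :
    Module.finrank E (torsionBy E[X] (E[X] ⧸ Ideal.span {c * d}) d) = d.natDegree := by
  -- the map `r ↦ r c mod (c d)`
  let φ : E[X] →ₗ[E[X]] E[X] ⧸ Ideal.span {c * d} :=
    (Submodule.mkQ (Ideal.span {c * d})).comp (LinearMap.mulRight E[X] c)
  have hφ : ∀ r, φ r = Submodule.Quotient.mk (r * c) := fun r => rfl
  have hker : LinearMap.ker φ = Ideal.span {d} := by
    ext r
    rw [LinearMap.mem_ker, hφ, Submodule.Quotient.mk_eq_zero, Ideal.mem_span_singleton,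
      Ideal.mem_span_singleton]
    constructor
    · rintro ⟨s, hs⟩
      refine ⟨s, mul_right_cancel₀ hc ?_⟩
      rw [hs]; ring
    · rintro ⟨s, rfl⟩
      exact ⟨s, by ring⟩
  have hrange : LinearMap.range φ = torsionBy E[X] (E[X] ⧸ Ideal.span {c * d}) d := by
    ext m
    rw [LinearMap.mem_range, mem_torsionBy_iff]
    constructor
    · rintro ⟨r, rfl⟩
      rw [hφ, ← Submodule.Quotient.mk_smul, Submodule.Quotient.mk_eq_zero, smul_eq_mul]
      exact Ideal.mem_span_singleton.mpr ⟨r, by ring⟩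
    · intro hm
      obtain ⟨f, rfl⟩ := Submodule.Quotient.mk_surjective _ m
      rw [← Submodule.Quotient.mk_smul, Submodule.Quotient.mk_eq_zero, smul_eq_mul,
        Ideal.mem_span_singleton] at hm
      obtain ⟨s, hs⟩ := hm
      have hf : f = s * c := mul_left_cancel₀ hd (by rw [hs]; ring)
      exact ⟨s, by rw [hφ, hf]⟩
  have e₁ := (φ.quotKerEquivRange).restrictScalars E
  rw [← hrange, ← e₁.finrank_eq, hker]
  exact finrank_quotient_span_eq_natDegree

/-- `E`-dimension of the `q^k`-torsion of `E[X] ⧸ (q^e)`: `min k e · deg q`. [folklore] -/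
theorem finrank_torsionBy_quotient_span_pow {q : E[X]} (hq : q ≠ 0) (k e : ℕ) :
    Module.finrank E (torsionBy E[X] (E[X] ⧸ Ideal.span {q ^ e}) (q ^ k)) =
      min k e * q.natDegree := by
  rcases le_total k e with hke | hek
  · rw [min_eq_left hke]
    have h : q ^ e = q ^ (e - k) * q ^ k := by rw [← pow_add, Nat.sub_add_cancel hke]
    rw [h, finrank_torsionBy_quotient_span_mul (pow_ne_zero _ hq) (pow_ne_zero _ hq),
      natDegree_pow]
  · rw [min_eq_right hek]
    have htop : torsionBy E[X] (E[X] ⧸ Ideal.span {q ^ e}) (q ^ k) = ⊤ := by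
      rw [eq_top_iff]
      intro m _
      obtain ⟨f, rfl⟩ := Submodule.Quotient.mk_surjective _ m
      rw [mem_torsionBy_iff, ← Submodule.Quotient.mk_smul, Submodule.Quotient.mk_eq_zero,
        smul_eq_mul]
      exact Ideal.mul_mem_right _ _ (Ideal.mem_span_singleton.mpr (pow_dvd_pow q hek))
    rw [htop, ((Submodule.topEquiv
        (R := E[X]) (M := E[X] ⧸ Ideal.span {q ^ e})).restrictScalars E).finrank_eq,
      finrank_quotient_span_eq_natDegree, natDegree_pow]

end Cyclic

section TorsionBy

variable {R : Type*} [CommRing R] {M M' : Type*} [AddCommMonoid M] [Module R M]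
  [AddCommMonoid M'] [Module R M']

/-- Torsion submodules correspond under linear equivalences. [folklore] -/
theorem map_torsionBy_linearEquiv (e : M ≃ₗ[R] M') (b : R) :
    (torsionBy R M b).map (e : M →ₗ[R] M') = torsionBy R M' b := by
  ext m'
  simp only [Submodule.mem_map, mem_torsionBy_iff, LinearEquiv.coe_coe]
  constructor
  · rintro ⟨m, hm, rfl⟩
    rw [← map_smul, hm, map_zero]
  · intro hm'
    refine ⟨e.symm m', ?_, e.apply_symm_apply m'⟩
    rw [← map_smul, hm', map_zero]

/-- The `b`-torsion of a finite product is the product of the `b`-torsions. [folklore] -/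
theorem torsionBy_pi {J : Type*} (N : J → Type*) [∀ j, AddCommMonoid (N j)]
    [∀ j, Module R (N j)] (b : R) :
    torsionBy R (∀ j, N j) b = Submodule.pi Set.univ fun j => torsionBy R (N j) b := by
  ext f
  simp only [mem_torsionBy_iff, Submodule.mem_pi, Set.mem_univ, true_implies]
  exact ⟨fun h j => by rw [← Pi.smul_apply, h, Pi.zero_apply], fun h => funext h⟩

end TorsionBy

section DirectSum

variable {E : Type*} [Field E] {J : Type*} [Fintype J]

/-- `E[X]/(a)` is finite-dimensional over `E` for `a ≠ 0` (power basis). [folklore] -/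
theorem finite_quotient_span {a : E[X]} (ha : a ≠ 0) :
    Module.Finite E (E[X] ⧸ Ideal.span {a}) :=
  (AdjoinRoot.powerBasis ha).finite

/-- The `E`-dimension of the `b`-torsion of `⨁ⱼ E[X]/(aⱼ)` is the sum of those of the
summands. [folklore] -/
theorem finrank_torsionBy_directSum (a : J → E[X]) (ha : ∀ j, a j ≠ 0) (b : E[X]) :
    Module.finrank E (torsionBy E[X] (⨁ j, E[X] ⧸ Ideal.span {a j}) b) =
      ∑ j, Module.finrank E (torsionBy E[X] (E[X] ⧸ Ideal.span {a j}) b) := by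
  let N : J → Type _ := fun j => E[X] ⧸ Ideal.span {a j}
  haveI : ∀ j, Module.Finite E (N j) := fun j => finite_quotient_span (ha j)
  haveI : ∀ j, Module.Finite E (torsionBy E[X] (N j) b) := fun j =>
    Module.Finite.of_injective ((torsionBy E[X] (N j) b).subtype.restrictScalars E)
      Subtype.val_injective
  haveI : ∀ j, Module.Free E (torsionBy E[X] (N j) b) := fun j => Module.Free.of_divisionRing E _
  let e₁ : (⨁ j, N j) ≃ₗ[E[X]] ∀ j, N j := DirectSum.linearEquivFunOnFintype E[X] J N
  have h₁ := map_torsionBy_linearEquiv e₁ b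
  let e₂ : torsionBy E[X] (⨁ j, N j) b ≃ₗ[E[X]] torsionBy E[X] (∀ j, N j) b :=
    LinearEquiv.ofSubmodules e₁ _ _ h₁
  rw [torsionBy_pi] at e₂
  -- `Submodule.pi univ P ≃ Π j, P j`
  let e₃ : (Submodule.pi Set.univ fun j => torsionBy E[X] (N j) b) ≃ₗ[E[X]]
      ∀ j, torsionBy E[X] (N j) b :=
    { toFun := fun f j => ⟨f.1 j, f.2 j (Set.mem_univ j)⟩
      map_add' := fun _ _ => rfl
      map_smul' := fun _ _ => rfl
      invFun := fun g => ⟨fun j => g j, fun j _ => (g j).2⟩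
      left_inv := fun _ => rfl
      right_inv := fun _ => rfl }
  rw [((e₂.trans e₃).restrictScalars E).finrank_eq, Module.finrank_pi_fintype]

variable (p : J → E[X]) (e : J → ℕ)

open scoped Classical in
/-- Summand-wise value: the `E`-dimension of the `q^k`-torsion of `E[X]/(p^e)` for irreducible
`p, q` is `min k e · deg q` if `q ∼ p` and `0` otherwise. [folklore] -/
theorem finrank_torsionBy_quotient_span_irreducible_pow {p q : E[X]} (hp : Irreducible p)
    (hq : Irreducible q) (k e : ℕ) :
    Module.finrank E (torsionBy E[X] (E[X] ⧸ Ideal.span {p ^ e}) (q ^ k)) =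
      if Associated q p then min k e * q.natDegree else 0 := by
  split_ifs with hqp
  · -- `(p^e) = (q^e)`: transport to the cyclic computation
    have hI : (Ideal.span {p ^ e} : Ideal E[X]) = Ideal.span {q ^ e} :=
      Ideal.span_singleton_eq_span_singleton.mpr (hqp.symm.pow_pow)
    let e₁ : (E[X] ⧸ Ideal.span {p ^ e}) ≃ₗ[E[X]] E[X] ⧸ Ideal.span {q ^ e} :=
      Submodule.quotEquivOfEq _ _ hI
    let e₂ := LinearEquiv.ofSubmodules e₁ _ _ (map_torsionBy_linearEquiv e₁ (q ^ k))
    rw [(e₂.restrictScalars E).finrank_eq]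
    exact finrank_torsionBy_quotient_span_pow hq.ne_zero k e
  · have hcop : IsCoprime (q ^ k) (p ^ e) := by
      refine IsCoprime.pow ((hq.coprime_iff_not_dvd).mpr fun hdvd => hqp ?_)
      exact hq.associated_of_dvd hp hdvd
    rw [torsionBy_quotient_span_eq_bot_of_isCoprime hcop]
    exact Module.finrank_zero_of_subsingleton

open scoped Classical in
/-- **Counting the elementary divisors.** In `M = ⨁ⱼ E[X]/(pⱼ^{eⱼ})` (`pⱼ` irreducible), for an
irreducible `q` and `k ≥ 1`, `deg q · #{j : q ∼ pⱼ, eⱼ ≥ k} = dim_E M[q^k] - dim_E M[q^{k-1}]`;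
so the number of summands of each type is determined by the module. [folklore] -/
theorem natDegree_mul_card_filter_add_finrank_torsionBy (hp : ∀ j, Irreducible (p j)) {q : E[X]}
    (hq : Irreducible q) {k : ℕ} (hk : 1 ≤ k) :
    q.natDegree * (Finset.univ.filter fun j => Associated q (p j) ∧ k ≤ e j).card +
        Module.finrank E (torsionBy E[X] (⨁ j, E[X] ⧸ Ideal.span {p j ^ e j}) (q ^ (k - 1))) =
      Module.finrank E (torsionBy E[X] (⨁ j, E[X] ⧸ Ideal.span {p j ^ e j}) (q ^ k)) := by
  have ha : ∀ j, p j ^ e j ≠ 0 := fun j => pow_ne_zero _ (hp j).ne_zero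
  rw [finrank_torsionBy_directSum _ ha, finrank_torsionBy_directSum _ ha, Finset.card_filter,
    Finset.mul_sum, ← Finset.sum_add_distrib]
  refine Finset.sum_congr rfl fun j _ => ?_
  rw [finrank_torsionBy_quotient_span_irreducible_pow (hp j) hq,
    finrank_torsionBy_quotient_span_irreducible_pow (hp j) hq]
  by_cases hA : Associated q (p j)
  · by_cases hke : k ≤ e j
    · simp only [hA, hke, and_self, if_true, mul_one, min_eq_left hke,
        min_eq_left (le_trans (Nat.sub_le k 1) hke)]
      obtain ⟨k', rfl⟩ := Nat.exists_eq_add_of_le' hk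
      rw [Nat.add_sub_cancel]
      ring
    · have hek : e j ≤ k - 1 := Nat.le_sub_one_of_lt (not_le.mp hke)
      simp only [hA, hke, and_false, if_false, if_true, mul_zero, zero_add, min_eq_right hek,
        min_eq_right (not_le.mp hke).le]
  · simp only [hA, false_and, if_false, mul_zero, add_zero]

end DirectSum

section Nullity

variable {E : Type*} [Field E] {n : Type*} [Fintype n] [DecidableEq n]

omit [DecidableEq n] in
/-- Rank–nullity for a square matrix: `dim ker M + rank M = n`. [folklore] -/
theorem finrank_ker_mulVecLin_add_rank (M : Matrix n n E) :
    Module.finrank E (LinearMap.ker M.mulVecLin) + M.rank = Fintype.card n := by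
  rw [Matrix.rank, add_comm, LinearMap.finrank_range_add_finrank_ker,
    Module.finrank_fintype_fun_eq_card]

/-- The nullity is invariant under conjugation by `GL_n`. [folklore] -/
theorem finrank_ker_mulVecLin_conj (M : Matrix n n E) (x : GL n E) :
    Module.finrank E
        (LinearMap.ker (((x⁻¹ : GL n E) : Matrix n n E) * M * (x : Matrix n n E)).mulVecLin) =
      Module.finrank E (LinearMap.ker M.mulVecLin) := by
  have h₁ := finrank_ker_mulVecLin_add_rank
    (((x⁻¹ : GL n E) : Matrix n n E) * M * (x : Matrix n n E))
  have h₂ := finrank_ker_mulVecLin_add_rank M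
  have hx : IsUnit (x : Matrix n n E).det :=
    (Matrix.isUnit_iff_isUnit_det _).mp (Units.isUnit x)
  have hx' : IsUnit ((x⁻¹ : GL n E) : Matrix n n E).det :=
    (Matrix.isUnit_iff_isUnit_det _).mp (Units.isUnit x⁻¹)
  rw [Matrix.rank_mul_eq_left_of_isUnit_det _ _ hx,
    Matrix.rank_mul_eq_right_of_isUnit_det _ _ hx'] at h₁
  omega

omit [DecidableEq n] in
/-- The rank of a matrix is invariant under a field automorphism applied entrywise. [folklore] -/
theorem rank_map_ringEquiv (M : Matrix n n E) (σ : E ≃+* E) : (M.map σ).rank = M.rank := by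
  -- the semilinear bijection `v ↦ σ ∘ v` maps `range M` onto `range M^σ`
  have hmem : ∀ v : n → E, v ∈ LinearMap.range M.mulVecLin →
      (σ ∘ v) ∈ LinearMap.range (M.map (σ : E →+* E)).mulVecLin := by
    rintro _ ⟨w, rfl⟩
    refine ⟨σ ∘ w, funext fun i => ?_⟩
    rw [Matrix.mulVecLin_apply, Matrix.mulVecLin_apply, Function.comp_apply]
    exact (RingHom.map_mulVec (σ : E →+* E) M w i).symm
  have hmem' : ∀ v : n → E, v ∈ LinearMap.range (M.map (σ : E →+* E)).mulVecLin →
      (σ.symm ∘ v) ∈ LinearMap.range M.mulVecLin := by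
    rintro _ ⟨w, rfl⟩
    refine ⟨σ.symm ∘ w, funext fun i => ?_⟩
    rw [Matrix.mulVecLin_apply, Matrix.mulVecLin_apply, Function.comp_apply]
    have h := RingHom.map_mulVec (σ.symm : E →+* E) (M.map (σ : E →+* E)) w i
    rw [Matrix.map_map] at h
    have hid : (⇑(σ.symm : E →+* E) ∘ ⇑(σ : E →+* E)) = id :=
      funext fun e => σ.symm_apply_apply e
    rw [hid, Matrix.map_id] at h
    exact h.symm
  let j : LinearMap.range M.mulVecLin ≃+ LinearMap.range (M.map (σ : E →+* E)).mulVecLin :=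
    { toFun := fun v => ⟨σ ∘ v.1, hmem v.1 v.2⟩
      invFun := fun v => ⟨σ.symm ∘ v.1, hmem' v.1 v.2⟩
      left_inv := fun v => Subtype.ext (funext fun i => σ.symm_apply_apply _)
      right_inv := fun v => Subtype.ext (funext fun i => σ.apply_symm_apply _)
      map_add' := fun v w => Subtype.ext (funext fun i => map_add σ _ _) }
  have hrank := rank_eq_of_equiv_equiv (σ : E → E) j σ.bijective
    (fun r v => Subtype.ext (funext fun i => map_mul σ r (v.1 i)))
  rw [Matrix.rank, Matrix.rank, Module.finrank, Module.finrank, hrank]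
  rfl

omit [DecidableEq n] in
/-- The nullity is invariant under a field automorphism applied entrywise. [folklore] -/
theorem finrank_ker_mulVecLin_map_ringEquiv (M : Matrix n n E) (σ : E ≃+* E) :
    Module.finrank E (LinearMap.ker (M.map σ).mulVecLin) =
      Module.finrank E (LinearMap.ker M.mulVecLin) := by
  have h₁ := finrank_ker_mulVecLin_add_rank (M.map σ)
  have h₂ := finrank_ker_mulVecLin_add_rank M
  rw [rank_map_ringEquiv] at h₁
  omega

/-- `σ` applied entrywise commutes with polynomial evaluation at a matrix:
`(b(U))^σ = b^σ(U^σ)`. [folklore] -/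
theorem map_aeval_ringHom (U : Matrix n n E) (σ : E →+* E) (b : E[X]) :
    (aeval U b).map σ = aeval (U.map σ) (b.map σ) := by
  have h := Polynomial.hom_eval₂ b (algebraMap E (Matrix n n E)) σ.mapMatrix U
  rw [aeval_def, aeval_def, eval₂_map]
  have hcomp : (σ.mapMatrix : Matrix n n E →+* Matrix n n E).comp (algebraMap E (Matrix n n E)) =
      (algebraMap E (Matrix n n E)).comp σ := by
    ext e i j
    simp [Matrix.algebraMap_matrix_apply, apply_ite σ]
  rw [← hcomp]
  exact h

/-- Polynomial evaluation commutes with conjugation: `b(x⁻¹ U x) = x⁻¹ b(U) x`. [folklore] -/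
theorem aeval_units_conj (U : Matrix n n E) (x : GL n E) (b : E[X]) :
    aeval (((x⁻¹ : GL n E) : Matrix n n E) * U * (x : Matrix n n E)) b =
      ((x⁻¹ : GL n E) : Matrix n n E) * aeval U b * (x : Matrix n n E) := by
  induction b using Polynomial.induction_on' with
  | add p q hp hq => rw [map_add, map_add, hp, hq, mul_add, add_mul]
  | monomial k c =>
    rw [aeval_monomial, aeval_monomial, Units.conj_pow']
    conv_rhs => rw [Algebra.left_comm, mul_assoc]

/-- **Nullity invariance.** If `U^σ = x⁻¹ U x`, then for every polynomial `b`,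
`dim ker b^σ(U) = dim ker b(U)`. [folklore] -/
theorem finrank_ker_aeval_map_eq (U : Matrix n n E) (σ : E ≃+* E) (x : GL n E)
    (hU : U.map σ = ((x⁻¹ : GL n E) : Matrix n n E) * U * (x : Matrix n n E)) (b : E[X]) :
    Module.finrank E (LinearMap.ker (aeval U (b.map (σ : E →+* E))).mulVecLin) =
      Module.finrank E (LinearMap.ker (aeval U b).mulVecLin) := by
  rw [← finrank_ker_mulVecLin_map_ringEquiv (aeval U b) σ]
  have h : (aeval U b).map σ = aeval (U.map σ) (b.map (σ : E →+* E)) :=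
    map_aeval_ringHom U (σ : E →+* E) b
  rw [h, hU, aeval_units_conj, finrank_ker_mulVecLin_conj]

end Nullity

section Perm

open Finset

/-- **Relabelling lemma.** Let `lab : J → Λ` be a labelling of a finite set and `s : Λ → Λ` a
map with `s^ℓ = id` such that the fibres of `lab` over `λ` and `s λ` always have the same size.
Then there is a self-map `π` of `J` shifting labels (`lab ∘ π = s ∘ lab`) with `π^ℓ = id`.
(Rank the elements of each fibre; send the `m`-th element of the fibre of `λ` to the `m`-th element
of the fibre of `s λ`.) [folklore] -/
theorem exists_iterate_eq_of_card_fibre_eq {J Λ : Type*} [Fintype J] [DecidableEq Λ]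
    (lab : J → Λ) (s : Λ → Λ) {ℓ : ℕ} (hs : ∀ μ, s^[ℓ] μ = μ)
    (h : ∀ μ, (univ.filter fun j => lab j = μ).card = (univ.filter fun j => lab j = s μ).card) :
    ∃ π : J → J, (∀ j, lab (π j) = s (lab j)) ∧ ∀ j, π^[ℓ] j = j := by
  classical
  letI : LinearOrder J := LinearOrder.lift' (Fintype.equivFin J) (Fintype.equivFin J).injective
  -- fibres and ranks
  let S : Λ → Finset J := fun μ => univ.filter fun j => lab j = μ
  have hS : ∀ μ j, j ∈ S μ ↔ lab j = μ := fun μ j => by simp [S]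
  let rk : J → ℕ := fun j => ((S (lab j)).filter fun x => x < j).card
  have hrk : ∀ j, rk j = ((S (lab j)).filter fun x => x < j).card := fun _ => rfl
  -- (F2) ranks are smaller than the fibre size
  have hF2 : ∀ j, rk j < (S (lab j)).card := fun j => by
    rw [hrk]
    apply card_lt_card
    refine ⟨filter_subset _ _, fun hsub => ?_⟩
    have hj : j ∈ (S (lab j)).filter fun x => x < j := hsub ((hS _ _).mpr rfl)
    exact lt_irrefl j (mem_filter.mp hj).2
  -- (F1) `(lab, rk)` is injective
  have hmono : ∀ j j', lab j = lab j' → j < j' → rk j < rk j' := fun j j' hl hjj' => by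
    rw [hrk, hrk, hl]
    apply card_lt_card
    refine ⟨fun x hx => ?_, fun hsub => ?_⟩
    · rw [mem_filter] at hx ⊢
      exact ⟨hx.1, hx.2.trans hjj'⟩
    · have hj : j ∈ (S (lab j')).filter fun x => x < j := by
        apply hsub
        rw [mem_filter, hS]
        exact ⟨hl, hjj'⟩
      exact lt_irrefl j (mem_filter.mp hj).2
  have hF1 : ∀ j j', lab j = lab j' → rk j = rk j' → j = j' := fun j j' hl hr => by
    rcases lt_trichotomy j j' with hlt | heq | hgt
    · exact absurd hr (hmono j j' hl hlt).ne
    · exact heq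
    · exact absurd hr (hmono j' j hl.symm hgt).ne'
  -- (F3) every rank below the fibre size is attained in the fibre
  have hF3 : ∀ μ m, m < (S μ).card → ∃ j, lab j = μ ∧ rk j = m := fun μ m hm => by
    have hsurj := Finset.surj_on_of_inj_on_of_card_le (s := S μ) (t := range (S μ).card)
      (fun j _ => rk j)
      (fun j hj => by
        rw [mem_range, ← (hS μ j).mp hj]
        exact hF2 j)
      (fun j₁ j₂ hj₁ hj₂ heq =>
        hF1 j₁ j₂ (((hS μ j₁).mp hj₁).trans ((hS μ j₂).mp hj₂).symm) heq)
      (by rw [card_range])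
    obtain ⟨j, hj, hjm⟩ := hsurj m (mem_range.mpr hm)
    exact ⟨j, (hS μ j).mp hj, hjm.symm⟩
  -- the relabelling map
  have hex : ∀ j, ∃ j', lab j' = s (lab j) ∧ rk j' = rk j := fun j =>
    hF3 (s (lab j)) (rk j) (by rw [← h (lab j)]; exact hF2 j)
  choose π hπlab hπrk using hex
  refine ⟨π, hπlab, fun j => ?_⟩
  have hiter : ∀ k j, lab (π^[k] j) = s^[k] (lab j) ∧ rk (π^[k] j) = rk j := by
    intro k
    induction k with
    | zero => intro j; exact ⟨rfl, rfl⟩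
    | succ k ih =>
      intro j
      rw [Function.iterate_succ_apply', Function.iterate_succ_apply']
      exact ⟨(hπlab _).trans (by rw [(ih j).1]), (hπrk _).trans (ih j).2⟩
  exact hF1 _ _ ((hiter ℓ j).1.trans (hs _)) (hiter ℓ j).2

end Perm

section Relabel

variable {E : Type*} [Field E] {J : Type*} [DecidableEq J]

/-- Changing the index along an equality does not change `of j (f mod aⱼ)`. [folklore] -/
theorem directSum_of_mk_congr (a : J → E[X]) {i i' : J} (h : i = i') (f : E[X]) :
    DirectSum.of (fun j => E[X] ⧸ Ideal.span {a j}) i (Ideal.Quotient.mk (Ideal.span {a i}) f) =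
      DirectSum.of (fun j => E[X] ⧸ Ideal.span {a j}) i'
        (Ideal.Quotient.mk (Ideal.span {a i'}) f) := by
  subst h
  rfl

/-- **The relabelling map.** Given `σ : E → E`, moduli `aⱼ ∈ E[X]` and a self-map `π` of the
index set with `a_{π j} ∣ σ(aⱼ)`, there is an additive self-map `Ψ` of `⨁ⱼ E[X]/(aⱼ)` sending
`f mod aⱼ` (in position `j`) to `σ f mod a_{π j}` (in position `π j`); it is `σ`-semilinear over
`E[X]`: `Ψ (g • m) = σ(g) • Ψ m`. [folklore] -/
theorem exists_addMonoidEnd_directSum_relabel (σ : E →+* E) (a : J → E[X]) (π : J → J)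
    (hπ : ∀ j, a (π j) ∣ (a j).map σ) :
    ∃ Ψ : AddMonoid.End (⨁ j, E[X] ⧸ Ideal.span {a j}),
      (∀ (g : E[X]) (m : ⨁ j, E[X] ⧸ Ideal.span {a j}), Ψ (g • m) = g.map σ • Ψ m) ∧
      ∀ (j : J) (f : E[X]),
        Ψ (DirectSum.of (fun j => E[X] ⧸ Ideal.span {a j}) j
            (Ideal.Quotient.mk (Ideal.span {a j}) f)) =
          DirectSum.of (fun j => E[X] ⧸ Ideal.span {a j}) (π j)
            (Ideal.Quotient.mk (Ideal.span {a (π j)}) (f.map σ)) := by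
  let N : J → Type _ := fun j => E[X] ⧸ Ideal.span {a j}
  have hle : ∀ j, Ideal.span {a j} ≤ (Ideal.span {a (π j)}).comap (mapRingHom σ) := fun j => by
    rw [Ideal.span_singleton_le_iff_mem, Ideal.mem_comap, Ideal.mem_span_singleton]
    exact hπ j
  let q : ∀ j, N j →+* N (π j) := fun j =>
    Ideal.quotientMap (Ideal.span {a (π j)}) (mapRingHom σ) (hle j)
  have hq : ∀ j (f : E[X]), q j (Ideal.Quotient.mk _ f) = Ideal.Quotient.mk _ (f.map σ) :=
    fun j f => Ideal.quotientMap_mk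
  let Ψ : AddMonoid.End (⨁ j, N j) :=
    DirectSum.toAddMonoid fun j => (DirectSum.of N (π j)).comp (q j).toAddMonoidHom
  have hΨ : ∀ (j : J) (f : E[X]), Ψ (DirectSum.of N j (Ideal.Quotient.mk _ f)) =
      DirectSum.of N (π j) (Ideal.Quotient.mk _ (f.map σ)) := fun j f => by
    show DirectSum.toAddMonoid _ (DirectSum.of N j _) = _
    rw [DirectSum.toAddMonoid_of, AddMonoidHom.comp_apply, RingHom.toAddMonoidHom_eq_coe,
      AddMonoidHom.coe_coe, hq]
  refine ⟨Ψ, fun g m => ?_, hΨ⟩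
  -- semilinearity, by induction over the direct sum
  induction m using DirectSum.induction_on with
  | zero => rw [smul_zero, map_zero, smul_zero]
  | add x y hx hy => rw [smul_add, map_add, map_add, smul_add, hx, hy]
  | of j y =>
    obtain ⟨f, rfl⟩ := Ideal.Quotient.mk_surjective y
    have hsmul : ∀ (i : J) (g f : E[X]),
        g • DirectSum.of N i (Ideal.Quotient.mk _ f) = DirectSum.of N i (Ideal.Quotient.mk _ (g * f)) :=
      fun i g f => by
        rw [← DirectSum.lof_eq_of E[X], ← DirectSum.lof_eq_of E[X], ← map_smul]
        congr 1
    rw [hsmul, hΨ, hΨ, hsmul, Polynomial.map_mul]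

/-- Iterating the relabelling map: `Ψ^k (f mod aⱼ @ j) = (σ^k f mod _ @ π^k j)`. [folklore] -/
theorem addMonoidEnd_directSum_relabel_pow_apply (σ : E →+* E) (a : J → E[X]) (π : J → J)
    (Ψ : AddMonoid.End (⨁ j, E[X] ⧸ Ideal.span {a j}))
    (hΨ : ∀ (j : J) (f : E[X]),
        Ψ (DirectSum.of (fun j => E[X] ⧸ Ideal.span {a j}) j
            (Ideal.Quotient.mk (Ideal.span {a j}) f)) =
          DirectSum.of (fun j => E[X] ⧸ Ideal.span {a j}) (π j)
            (Ideal.Quotient.mk (Ideal.span {a (π j)}) (f.map σ)))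
    (k : ℕ) (j : J) (f : E[X]) :
    (Ψ ^ k) (DirectSum.of (fun j => E[X] ⧸ Ideal.span {a j}) j
        (Ideal.Quotient.mk (Ideal.span {a j}) f)) =
      DirectSum.of (fun j => E[X] ⧸ Ideal.span {a j}) (π^[k] j)
        (Ideal.Quotient.mk (Ideal.span {a (π^[k] j)}) (f.map (σ ^ k))) := by
  induction k generalizing j f with
  | zero =>
    rw [pow_zero, pow_zero, AddMonoid.End.coe_one, id_eq, RingHom.one_def, Polynomial.map_id]
    rfl
  | succ k ih =>
    rw [pow_succ', AddMonoid.End.coe_mul, Function.comp_apply, ih, hΨ, Polynomial.map_map,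
      ← RingHom.mul_def, ← pow_succ']
    exact directSum_of_mk_congr a (Function.iterate_succ_apply' π k j).symm _

/-- If `π^ℓ = id` and `σ^ℓ = 1`, the relabelling map satisfies `Ψ^ℓ = 1`. [folklore] -/
theorem addMonoidEnd_directSum_relabel_pow_apply_eq_self (σ : E →+* E) (a : J → E[X])
    (π : J → J) (Ψ : AddMonoid.End (⨁ j, E[X] ⧸ Ideal.span {a j}))
    (hΨ : ∀ (j : J) (f : E[X]),
        Ψ (DirectSum.of (fun j => E[X] ⧸ Ideal.span {a j}) j
            (Ideal.Quotient.mk (Ideal.span {a j}) f)) =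
          DirectSum.of (fun j => E[X] ⧸ Ideal.span {a j}) (π j)
            (Ideal.Quotient.mk (Ideal.span {a (π j)}) (f.map σ)))
    {ℓ : ℕ} (hπ : ∀ j, π^[ℓ] j = j) (hσ : σ ^ ℓ = 1) (m : ⨁ j, E[X] ⧸ Ideal.span {a j}) :
    (Ψ ^ ℓ) m = m := by
  induction m using DirectSum.induction_on with
  | zero => exact map_zero _
  | add x y hx hy => rw [map_add, hx, hy]
  | of j y =>
    obtain ⟨f, rfl⟩ := Ideal.Quotient.mk_surjective y
    have h := addMonoidEnd_directSum_relabel_pow_apply σ a π Ψ hΨ ℓ j f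
    rw [hσ, RingHom.one_def, Polynomial.map_id] at h
    rw [h]
    exact directSum_of_mk_congr a (hπ j) f

/-- If `π^ℓ = id` and `σ^ℓ = 1`, the relabelling map satisfies `Ψ^ℓ = 1`. [folklore] -/
theorem addMonoidEnd_directSum_relabel_pow_eq_one (σ : E →+* E) (a : J → E[X]) (π : J → J)
    (Ψ : AddMonoid.End (⨁ j, E[X] ⧸ Ideal.span {a j}))
    (hΨ : ∀ (j : J) (f : E[X]),
        Ψ (DirectSum.of (fun j => E[X] ⧸ Ideal.span {a j}) j
            (Ideal.Quotient.mk (Ideal.span {a j}) f)) =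
          DirectSum.of (fun j => E[X] ⧸ Ideal.span {a j}) (π j)
            (Ideal.Quotient.mk (Ideal.span {a (π j)}) (f.map σ)))
    {ℓ : ℕ} (hπ : ∀ j, π^[ℓ] j = j) (hσ : σ ^ ℓ = 1) : Ψ ^ ℓ = 1 :=
  DFunLike.ext _ _ fun m => by
    rw [addMonoidEnd_directSum_relabel_pow_apply_eq_self σ a π Ψ hΨ hπ hσ m,
      AddMonoid.End.coe_one, id_eq]

end Relabel

section Labels

variable {E : Type*} [Field E] {J : Type*} [Fintype J]

/-- A non-zero polynomial is associated to its monic associate `f · lc(f)⁻¹`. [folklore] -/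
theorem associated_mul_C_leadingCoeff_inv {f : E[X]} (hf : f ≠ 0) :
    Associated f (f * C f.leadingCoeff⁻¹) :=
  associated_mul_unit_right f _ (isUnit_C.mpr (IsUnit.mk0 _ (inv_ne_zero
    (leadingCoeff_ne_zero.mpr hf))))

/-- A monic `q` is associated to `f ≠ 0` iff it equals the monic associate of `f`. [folklore] -/
theorem associated_iff_mul_C_leadingCoeff_inv_eq {f q : E[X]} (hf : f ≠ 0) (hq : q.Monic) :
    Associated q f ↔ f * C f.leadingCoeff⁻¹ = q := by
  have hmon : (f * C f.leadingCoeff⁻¹).Monic := monic_mul_leadingCoeff_inv hf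
  have hass := associated_mul_C_leadingCoeff_inv hf
  constructor
  · intro h
    exact eq_of_monic_of_associated hmon hq (hass.symm.trans h.symm)
  · rintro rfl
    exact hass.symm

/-- Monicity and irreducibility are invariant under a field automorphism applied to the
coefficients. [folklore] -/
theorem monic_and_irreducible_map_iff (σ : E ≃+* E) (q : E[X]) :
    ((q.map (σ : E →+* E)).Monic ∧ Irreducible (q.map (σ : E →+* E))) ↔
      (q.Monic ∧ Irreducible q) := by
  have hirr : Irreducible (q.map (σ : E →+* E)) ↔ Irreducible q :=
    MulEquiv.irreducible_iff (mapEquiv σ)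
  have hmon : (q.map (σ : E →+* E)).Monic ↔ q.Monic := by
    refine ⟨fun h => ?_, fun h => h.map _⟩
    have h' := h.map (σ.symm : E →+* E)
    rw [Polynomial.map_map] at h'
    have hid : (σ.symm : E →+* E).comp (σ : E →+* E) = RingHom.id E :=
      RingHom.ext fun e => σ.symm_apply_apply e
    rwa [hid, Polynomial.map_id] at h'
  rw [hirr, hmon]

open scoped Classical in
/-- **Fibres of the labelling.** Label the index `j` of `⨁ⱼ E[X]/(pⱼ^{eⱼ})` by
`(monic associate of pⱼ, eⱼ)` (and by `(1, 0)` if `eⱼ = 0`). If for every monic irreducible `q`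
and `m ≥ 1` the numbers `#{j : q ∼ pⱼ, eⱼ ≥ m}` and `#{j : σq ∼ pⱼ, eⱼ ≥ m}` agree, then every
label `μ` and its shift `σμ` have fibres of the same size. [folklore] -/
theorem card_filter_label_eq (σ : E ≃+* E) (p : J → E[X]) (hp : ∀ j, Irreducible (p j))
    (e : J → ℕ)
    (hcount : ∀ q : E[X], q.Monic → Irreducible q → ∀ m : ℕ, 1 ≤ m →
      (univ.filter fun j => Associated q (p j) ∧ m ≤ e j).card =
        (univ.filter fun j => Associated (q.map (σ : E →+* E)) (p j) ∧ m ≤ e j).card)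
    (μ : E[X] × ℕ) :
    (univ.filter fun j =>
        (if e j = 0 then ((1 : E[X]), 0) else (p j * C (p j).leadingCoeff⁻¹, e j)) = μ).card =
      (univ.filter fun j =>
        (if e j = 0 then ((1 : E[X]), 0) else (p j * C (p j).leadingCoeff⁻¹, e j)) =
          (μ.1.map (σ : E →+* E), μ.2)).card := by
  obtain ⟨q, m⟩ := μ
  dsimp only
  have hinj : Function.Injective fun f : E[X] => f.map (σ : E →+* E) :=
    Polynomial.map_injective _ σ.injective
  rcases Nat.eq_zero_or_pos m with rfl | hm
  · -- labels `(q, 0)`: only the indices with `e j = 0`, and only if `q = 1`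
    have hiff : ∀ (r : E[X]) (j : J),
        ((if e j = 0 then ((1 : E[X]), 0) else (p j * C (p j).leadingCoeff⁻¹, e j)) = (r, 0)) ↔
          (e j = 0 ∧ r = 1) := fun r j => by
      split_ifs with hj
      · simp only [Prod.mk.injEq, and_true, hj, true_and, eq_comm]
      · simp only [Prod.mk.injEq, hj, and_false, false_and]
    have hq1 : q.map (σ : E →+* E) = 1 ↔ q = 1 := by
      constructor
      · intro h
        exact hinj (by simp only [h, Polynomial.map_one])
      · rintro rfl
        exact Polynomial.map_one _
    simp_rw [hiff, hq1]
  · -- labels `(q, m)`, `m ≥ 1`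
    have hm0 : m ≠ 0 := Nat.pos_iff_ne_zero.mp hm
    have hiff : ∀ (r : E[X]) (j : J),
        ((if e j = 0 then ((1 : E[X]), 0) else (p j * C (p j).leadingCoeff⁻¹, e j)) = (r, m)) ↔
          (p j * C (p j).leadingCoeff⁻¹ = r ∧ e j = m) := fun r j => by
      split_ifs with hj
      · simp only [Prod.mk.injEq, hj, Ne.symm hm0, and_false]
      · simp only [Prod.mk.injEq]
    simp_rw [hiff]
    by_cases hqmi : q.Monic ∧ Irreducible q
    · -- monic irreducible `q`: the fibre counts `#{j : q ∼ pⱼ, eⱼ = m}`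
      have hqσ := (monic_and_irreducible_map_iff σ q).mpr hqmi
      have hfib : ∀ r : E[X], r.Monic →
          (univ.filter fun j => p j * C (p j).leadingCoeff⁻¹ = r ∧ e j = m).card =
            (univ.filter fun j => Associated r (p j) ∧ m ≤ e j).card -
              (univ.filter fun j => Associated r (p j) ∧ m + 1 ≤ e j).card := fun r hr => by
        have h1 : (univ.filter fun j => p j * C (p j).leadingCoeff⁻¹ = r ∧ e j = m) =
            univ.filter fun j => Associated r (p j) ∧ e j = m := by
          refine Finset.filter_congr fun j _ => ?_
          rw [associated_iff_mul_C_leadingCoeff_inv_eq (hp j).ne_zero hr]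
        have h2 : (univ.filter fun j => Associated r (p j) ∧ m ≤ e j).card =
            (univ.filter fun j => Associated r (p j) ∧ e j = m).card +
              (univ.filter fun j => Associated r (p j) ∧ m + 1 ≤ e j).card := by
          rw [Finset.card_filter, Finset.card_filter, Finset.card_filter, ← Finset.sum_add_distrib]
          refine Finset.sum_congr rfl fun j _ => ?_
          by_cases hA : Associated r (p j)
          · simp only [hA, true_and]
            rcases lt_trichotomy (e j) m with hlt | heq | hgt
            · rw [if_neg (by omega), if_neg (by omega), if_neg (by omega)]
            · rw [if_pos (by omega), if_pos heq, if_neg (by omega)]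
            · rw [if_pos (by omega), if_neg (by omega), if_pos (by omega)]
          · simp only [hA, false_and, if_false, add_zero]
        rw [h1, h2, Nat.add_sub_cancel]
      rw [hfib q hqmi.1, hfib _ hqσ.1, hcount q hqmi.1 hqmi.2 m hm,
        hcount q hqmi.1 hqmi.2 (m + 1) (by omega)]
    · -- otherwise both fibres are empty
      have hempty : ∀ r : E[X], ¬ (r.Monic ∧ Irreducible r) →
          (univ.filter fun j => p j * C (p j).leadingCoeff⁻¹ = r ∧ e j = m).card = 0 := by
        intro r hr
        rw [Finset.card_eq_zero, Finset.filter_eq_empty_iff]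
        rintro j - ⟨hjr, -⟩
        apply hr
        rw [← hjr]
        exact ⟨monic_mul_leadingCoeff_inv (hp j).ne_zero,
          (associated_mul_C_leadingCoeff_inv (hp j).ne_zero).irreducible (hp j)⟩
      rw [hempty q hqmi, hempty _ fun h => hqmi ((monic_and_irreducible_map_iff σ q).mp h)]

end Labels

section Descent

variable {E : Type*} [Field E] {n : Type*} [Fintype n] [DecidableEq n]

/-- The kernel of `b(U)` on `Eⁿ` has the same `E`-dimension as the `b`-torsion of any
`E[X]`-module isomorphic to `(Eⁿ, U)`. [folklore] -/
theorem finrank_torsionBy_eq_finrank_ker_aeval (U : Matrix n n E) {M : Type*} [AddCommMonoid M]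
    [Module E[X] M] [Module E M] [IsScalarTower E E[X] M]
    (θ : Module.AEval' (Matrix.toLin' U) ≃ₗ[E[X]] M) (b : E[X]) :
    Module.finrank E (torsionBy E[X] M b) =
      Module.finrank E (LinearMap.ker (aeval U b).mulVecLin) := by
  let φ := Matrix.toLin' U
  let ofA : (n → E) ≃ₗ[E] Module.AEval' φ := Module.AEval'.of φ
  have e₁ : torsionBy E[X] (Module.AEval' φ) b ≃ₗ[E[X]] torsionBy E[X] M b :=
    LinearEquiv.ofSubmodules θ _ _ (map_torsionBy_linearEquiv θ b)
  have hmap : (LinearMap.ker (aeval φ b)).map (ofA : (n → E) →ₗ[E] Module.AEval' φ) =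
      (torsionBy E[X] (Module.AEval' φ) b).restrictScalars E := by
    ext a
    simp only [Submodule.mem_map, LinearMap.mem_ker, Submodule.restrictScalars_mem,
      mem_torsionBy_iff, LinearEquiv.coe_coe]
    constructor
    · rintro ⟨v, hv, rfl⟩
      rw [← Module.AEval.of_aeval_smul]
      change ofA ((aeval φ b) v) = 0
      rw [hv, map_zero]
    · intro ha
      refine ⟨ofA.symm a, ?_, ofA.apply_symm_apply a⟩
      apply ofA.injective
      change ofA (aeval φ b • ofA.symm a) = ofA 0
      rw [Module.AEval.of_aeval_smul, map_zero]
      change b • ofA (ofA.symm a) = 0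
      rwa [ofA.apply_symm_apply]
  have e₂ : LinearMap.ker (aeval φ b) ≃ₗ[E]
      (torsionBy E[X] (Module.AEval' φ) b).restrictScalars E :=
    LinearEquiv.ofSubmodules ofA _ _ hmap
  have hφ : aeval φ b = Matrix.toLin' (aeval U b) := by
    change aeval (Matrix.toLinAlgEquiv' U) b = Matrix.toLinAlgEquiv' (aeval U b)
    exact aeval_algHom_apply (Matrix.toLinAlgEquiv' : Matrix n n E ≃ₐ[E] _) U b
  rw [← (e₁.restrictScalars E).finrank_eq]
  change Module.finrank E ((torsionBy E[X] (Module.AEval' φ) b).restrictScalars E) = _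
  rw [← e₂.finrank_eq, hφ]
  rfl

open scoped Classical in
/-- **Invariance of the elementary-divisor counts.** If `U^σ = x⁻¹ U x` and
`(Eⁿ, U) ≅ ⨁ⱼ E[X]/(pⱼ^{eⱼ})`, then for every monic irreducible `q` and `m ≥ 1` the number of
`j` with `q ∼ pⱼ, eⱼ ≥ m` equals the number with `σq ∼ pⱼ, eⱼ ≥ m`. [folklore] -/
theorem card_filter_associated_eq_of_map_eq_conj (σ : E ≃+* E) (U : Matrix n n E) (x : GL n E)
    (hU : U.map σ = ((x⁻¹ : GL n E) : Matrix n n E) * U * (x : Matrix n n E))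
    {J : Type*} [Fintype J] (p : J → E[X]) (hp : ∀ j, Irreducible (p j)) (e : J → ℕ)
    (θ : Module.AEval' (Matrix.toLin' U) ≃ₗ[E[X]] ⨁ j, E[X] ⧸ Ideal.span {p j ^ e j})
    (q : E[X]) (hqm : q.Monic) (hq : Irreducible q) (m : ℕ) (hm : 1 ≤ m) :
    (univ.filter fun j => Associated q (p j) ∧ m ≤ e j).card =
      (univ.filter fun j => Associated (q.map (σ : E →+* E)) (p j) ∧ m ≤ e j).card := by
  have hqσ : Irreducible (q.map (σ : E →+* E)) :=
    ((monic_and_irreducible_map_iff σ q).mpr ⟨hqm, hq⟩).2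
  have hdeg : (q.map (σ : E →+* E)).natDegree = q.natDegree :=
    natDegree_map_eq_of_injective σ.injective q
  have hD : ∀ k, Module.finrank E (torsionBy E[X] (⨁ j, E[X] ⧸ Ideal.span {p j ^ e j})
      (q.map (σ : E →+* E) ^ k)) = Module.finrank E (torsionBy E[X]
        (⨁ j, E[X] ⧸ Ideal.span {p j ^ e j}) (q ^ k)) := fun k => by
    rw [finrank_torsionBy_eq_finrank_ker_aeval U θ, finrank_torsionBy_eq_finrank_ker_aeval U θ,
      ← Polynomial.map_pow, finrank_ker_aeval_map_eq U σ x hU]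
  have h1 := natDegree_mul_card_filter_add_finrank_torsionBy p e hp hq hm
  have h2 := natDegree_mul_card_filter_add_finrank_torsionBy p e hp hqσ hm
  rw [hdeg, hD, hD, ← h1] at h2
  have hpos : 0 < q.natDegree := natDegree_pos_iff_degree_pos.mpr (degree_pos_of_irreducible hq)
  exact (Nat.eq_of_mul_eq_mul_left hpos (Nat.add_right_cancel h2)).symm

/-- Powers of the entrywise map `τ = σ.mapMatrix` are the entrywise iterates of `σ`. [folklore] -/
theorem mapMatrix_pow_apply (σ : E →+* E) (k : ℕ) (M : Matrix n n E) :
    ((σ.mapMatrix : Matrix n n E →+* Matrix n n E) ^ k) M = M.map (⇑σ)^[k] := by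
  induction k generalizing M with
  | zero => rw [pow_zero, RingHom.one_def, RingHom.id_apply, Function.iterate_zero, Matrix.map_id]
  | succ k ih =>
    rw [pow_succ', RingHom.coe_mul, Function.comp_apply, ih, RingHom.mapMatrix_apply,
      Matrix.map_map, Function.iterate_succ']

/-- **The descent datum.** Let `σ` be an automorphism of finite order `ℓ` of the field `E` and
`U ∈ M_n(E)` with `U^σ = x⁻¹ U x` for some `x ∈ GL_n(E)`. Then there is `y ∈ M_n(E)` with
`y U^σ = U y` whose twisted norm `y · y^σ ⋯ y^{σ^{ℓ-1}}` is `1`. (It is the matrix of a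
`σ`-semilinear automorphism `Ψ` of `Eⁿ` of order dividing `ℓ` commuting with `U`, built by
permuting the summands of a decomposition `(Eⁿ, U) ≅ ⨁ⱼ E[X]/(pⱼ^{eⱼ})` along the action of
`σ` on the elementary divisors, which is possible because their multiplicities are
`σ`-invariant.) [folklore] -/
theorem exists_mul_map_eq_mul_and_prod_eq_one (σ : E ≃+* E) (U : Matrix n n E) (x : GL n E)
    (hU : U.map σ = ((x⁻¹ : GL n E) : Matrix n n E) * U * (x : Matrix n n E)) :
    ∃ y : Matrix n n E, y * U.map σ = U * y ∧
      ((List.range (orderOf σ)).map fun i =>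
        (((σ : E →+* E).mapMatrix : Matrix n n E →+* Matrix n n E) ^ i) y).prod = 1 := by
  classical
  -- the order of `σ`
  set ℓ := orderOf σ with hℓ
  have hσℓ : σ ^ ℓ = 1 := pow_orderOf_eq_one σ
  have hσiter : ∀ a : E, (⇑σ)^[ℓ] a = a := fun a => by
    rw [← RingAut.coe_pow, hσℓ, RingAut.coe_one, id_eq]
  let σ' : E →+* E := σ
  have hσ'coe : (⇑σ' : E → E) = ⇑σ := rfl
  have hσ'ℓ : σ' ^ ℓ = 1 := RingHom.ext fun a => by
    rw [RingHom.coe_pow, hσ'coe, hσiter, RingHom.one_def, RingHom.id_apply]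
  -- Step 1: the `E[X]`-module `(Eⁿ, U)` and its decomposition into cyclic primary modules
  let φ := Matrix.toLin' U
  let ofA : (n → E) ≃ₗ[E] Module.AEval' φ := Module.AEval'.of φ
  have hA : Module.IsTorsion E[X] (Module.AEval' φ) :=
    Module.AEval.isTorsion_of_finiteDimensional E (n → E) φ
  obtain ⟨J, _, p, hp, e, ⟨θ⟩⟩ := Module.equiv_directSum_of_isTorsion hA
  let N : J → Type _ := fun j => E[X] ⧸ Ideal.span {p j ^ e j}
  have θ' : Module.AEval' φ ≃ₗ[E[X]] ⨁ j, N j := θ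
  -- Step 2: labels `(monic associate of pⱼ, eⱼ)`, their shift by `σ`, and a relabelling `π`
  let lab : J → E[X] × ℕ := fun j =>
    if e j = 0 then ((1 : E[X]), 0) else (p j * C (p j).leadingCoeff⁻¹, e j)
  let s : E[X] × ℕ → E[X] × ℕ := fun μ => (μ.1.map σ', μ.2)
  have hs_iter : ∀ (k : ℕ) (μ : E[X] × ℕ), s^[k] μ = (μ.1.map (σ' ^ k), μ.2) := by
    intro k
    induction k with
    | zero =>
      intro μ
      rw [Function.iterate_zero, id_eq, pow_zero, RingHom.one_def, Polynomial.map_id]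
    | succ k ih =>
      intro μ
      rw [Function.iterate_succ_apply', ih]
      show ((μ.1.map (σ' ^ k)).map σ', μ.2) = _
      rw [Polynomial.map_map, ← RingHom.mul_def, ← pow_succ']
  have hs : ∀ μ, s^[ℓ] μ = μ := fun μ => by
    rw [hs_iter, hσ'ℓ, RingHom.one_def, Polynomial.map_id]
  have hfib : ∀ μ : E[X] × ℕ, (univ.filter fun j => lab j = μ).card =
      (univ.filter fun j => lab j = s μ).card := fun μ =>
    card_filter_label_eq σ p hp e (fun q hqm hq m hm =>
      card_filter_associated_eq_of_map_eq_conj σ U x hU p hp e θ' q hqm hq m hm) μ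
  obtain ⟨π, hπlab, hπℓ⟩ := exists_iterate_eq_of_card_fibre_eq lab s hs hfib
  -- Step 3: `p_{πj}^{e_{πj}}` divides `σ(pⱼ^{eⱼ})`
  have hdiv : ∀ j, p (π j) ^ e (π j) ∣ (p j ^ e j).map σ' := by
    intro j
    have hl := hπlab j
    by_cases hj : e j = 0
    · have h0 : e (π j) = 0 := by
        by_contra hne
        have hl' : (p (π j) * C (p (π j)).leadingCoeff⁻¹, e (π j)) = ((1 : E[X]).map σ', 0) := by
          simpa only [lab, s, if_pos hj, if_neg hne] using hl
        exact hne (Prod.ext_iff.mp hl').2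
      rw [h0, pow_zero]
      exact one_dvd _
    · have hne : e (π j) ≠ 0 := by
        intro h0
        have hl' : ((1 : E[X]), 0) = ((p j * C (p j).leadingCoeff⁻¹).map σ', e j) := by
          simpa only [lab, s, if_neg hj, if_pos h0] using hl
        exact hj (Prod.ext_iff.mp hl').2.symm
      have hl' : (p (π j) * C (p (π j)).leadingCoeff⁻¹, e (π j)) =
          ((p j * C (p j).leadingCoeff⁻¹).map σ', e j) := by
        simpa only [lab, s, if_neg hj, if_neg hne] using hl
      obtain ⟨h1, h2⟩ := Prod.ext_iff.mp hl'
      dsimp only at h1 h2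
      have hass1 := associated_mul_C_leadingCoeff_inv (hp (π j)).ne_zero
      have hass2 : Associated ((p j).map σ') ((p j * C (p j).leadingCoeff⁻¹).map σ') :=
        (associated_mul_C_leadingCoeff_inv (hp j).ne_zero).map (mapRingHom σ')
      have hass : Associated (p (π j)) ((p j).map σ') := by
        rw [← h1] at hass2
        exact hass1.trans hass2.symm
      rw [h2, Polynomial.map_pow]
      exact (hass.pow_pow).dvd
  -- Step 4: the relabelling map `Ψ` on the direct sum, `Ψ^ℓ = 1`
  obtain ⟨Ψ, hΨsl, hΨof⟩ :=
    exists_addMonoidEnd_directSum_relabel σ' (fun j => p j ^ e j) π hdiv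
  have hΨℓ : Ψ ^ ℓ = 1 :=
    addMonoidEnd_directSum_relabel_pow_eq_one σ' (fun j => p j ^ e j) π Ψ hΨof hπℓ hσ'ℓ
  -- Step 5: transport to `Eⁿ`: a `σ`-semilinear `ΨV` commuting with `U`, `ΨV^ℓ = id`
  let ΨV : (n → E) → (n → E) := fun v => ofA.symm (θ'.symm (Ψ (θ' (ofA v))))
  have hΨV_def : ∀ v, ΨV v = ofA.symm (θ'.symm (Ψ (θ' (ofA v)))) := fun _ => rfl
  have hΨV_add : ∀ v w, ΨV (v + w) = ΨV v + ΨV w := fun v w => by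
    simp only [hΨV_def, map_add]
  have hCsmulA : ∀ (c : E) (a : Module.AEval' φ), (C c : E[X]) • a = c • a := fun c a =>
    algebraMap_smul E[X] c a
  have hCsmulD : ∀ (c : E) (m : ⨁ j, N j), (C c : E[X]) • m = c • m := fun c m =>
    algebraMap_smul E[X] c m
  have hΨV_smul : ∀ (c : E) (v : n → E), ΨV (c • v) = σ c • ΨV v := fun c v => by
    rw [hΨV_def, hΨV_def, map_smul, ← hCsmulA, map_smul, hΨsl, Polynomial.map_C, map_smul,
      hCsmulA, map_smul]
    rfl
  have hΨV_U : ∀ v, ΨV (U *ᵥ v) = U *ᵥ ΨV v := fun v => by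
    have h1 : ofA (U *ᵥ v) = (X : E[X]) • ofA v := by
      rw [Module.AEval'.X_smul_of, Matrix.toLin'_apply]
    rw [hΨV_def, hΨV_def, h1, map_smul, hΨsl, Polynomial.map_X, map_smul,
      Module.AEval'.of_symm_X_smul, Matrix.toLin'_apply]
  have hΨV_iter : ∀ (k : ℕ) (v : n → E),
      ΨV^[k] v = ofA.symm (θ'.symm ((Ψ ^ k) (θ' (ofA v)))) := by
    intro k
    induction k with
    | zero =>
      intro v
      rw [Function.iterate_zero, id_eq, pow_zero, AddMonoid.End.coe_one, id_eq,
        LinearEquiv.symm_apply_apply, LinearEquiv.symm_apply_apply]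
    | succ k ih =>
      intro v
      rw [Function.iterate_succ_apply', ih, hΨV_def, LinearEquiv.apply_symm_apply,
        LinearEquiv.apply_symm_apply, pow_succ', AddMonoid.End.coe_mul, Function.comp_apply]
  have hΨV_ℓ : ∀ v, ΨV^[ℓ] v = v := fun v => by
    rw [hΨV_iter, hΨℓ, AddMonoid.End.coe_one, id_eq, LinearEquiv.symm_apply_apply,
      LinearEquiv.symm_apply_apply]
  -- Step 6: the matrix `y` of the `E`-linear map `ΨV ∘ σ⁻¹`
  let L : (n → E) →ₗ[E] (n → E) :=
    { toFun := fun v => ΨV (fun i => σ.symm (v i))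
      map_add' := fun v w => by
        have : (fun i => σ.symm ((v + w) i)) =
            (fun i => σ.symm (v i)) + fun i => σ.symm (w i) := by
          funext i
          rw [Pi.add_apply, Pi.add_apply, map_add]
        rw [this, hΨV_add]
      map_smul' := fun c v => by
        have : (fun i => σ.symm ((c • v) i)) = σ.symm c • fun i => σ.symm (v i) := by
          funext i
          rw [Pi.smul_apply, Pi.smul_apply, smul_eq_mul, smul_eq_mul, map_mul]
        rw [this, hΨV_smul, RingEquiv.apply_symm_apply, RingHom.id_apply] }
  have hL : ∀ v, L v = ΨV (fun i => σ.symm (v i)) := fun _ => rfl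
  let y : Matrix n n E := LinearMap.toMatrix' L
  have hy : ∀ v, y *ᵥ v = ΨV (fun i => σ.symm (v i)) := fun v => by
    rw [LinearMap.toMatrix'_mulVec, hL]
  have hyσ : ∀ w, ΨV w = y *ᵥ fun i => σ (w i) := fun w => by
    rw [hy]
    congr 1
    funext i
    rw [RingEquiv.symm_apply_apply]
  refine ⟨y, ?_, ?_⟩
  · -- `y U^σ = U y`
    refine Matrix.toLin'.injective (LinearMap.ext fun v => ?_)
    rw [Matrix.toLin'_apply, Matrix.toLin'_apply, ← Matrix.mulVec_mulVec,
      ← Matrix.mulVec_mulVec, hy, hy, ← hΨV_U]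
    congr 1
    funext i
    have h := RingHom.map_mulVec (σ.symm : E →+* E) (U.map σ') v i
    rw [Matrix.map_map] at h
    have hid : (⇑(σ.symm : E →+* E) ∘ ⇑σ') = id := funext fun a => σ.symm_apply_apply a
    rw [hid, Matrix.map_id] at h
    exact h
  · -- the twisted norm of `y` is `1`: `ΨV^k = N_k(y) ∘ σ^k` and `ΨV^ℓ = id`
    let τ : Matrix n n E →+* Matrix n n E := σ'.mapMatrix
    have hτ : ∀ M : Matrix n n E, τ M = M.map σ' := fun _ => rfl
    have hNk : ∀ (k : ℕ) (w : n → E),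
        ΨV^[k] w = ((List.range k).map fun i => (τ ^ i) y).prod *ᵥ fun i => (⇑σ)^[k] (w i) := by
      intro k
      induction k with
      | zero =>
        intro w
        rw [Function.iterate_zero, id_eq, List.range_zero, List.map_nil, List.prod_nil,
          Matrix.one_mulVec]
        rfl
      | succ k ih =>
        intro w
        rw [Function.iterate_succ_apply', ih, hyσ]
        have hvec : (⇑σ' ∘ fun i => (⇑σ)^[k] (w i)) = fun i => (⇑σ)^[k + 1] (w i) := by
          funext i
          rw [Function.comp_apply, Function.iterate_succ_apply']
          rfl
        have hmv : (fun i => σ ((((List.range k).map fun i => (τ ^ i) y).prod *ᵥ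
            fun i => (⇑σ)^[k] (w i)) i)) =
            (((List.range k).map fun i => (τ ^ i) y).prod).map σ' *ᵥ
              fun i => (⇑σ)^[k + 1] (w i) := by
          funext i
          rw [← hvec]
          exact RingHom.map_mulVec σ' _ _ i
        rw [hmv, Matrix.mulVec_mulVec]
        congr 1
        have hfun : (⇑τ ∘ fun i => (τ ^ i) y) = ((fun i => (τ ^ i) y) ∘ Nat.succ) := by
          funext i
          simp only [Function.comp_apply, pow_succ', RingHom.coe_mul]
        rw [← hτ, map_list_prod, List.map_map, List.range_succ_eq_map, List.map_cons,
          List.prod_cons, pow_zero, RingHom.one_def, RingHom.id_apply, List.map_map, hfun]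
    refine Matrix.toLin'.injective (LinearMap.ext fun w => ?_)
    rw [Matrix.toLin'_apply, Matrix.toLin'_apply, Matrix.one_mulVec]
    have h := hNk ℓ w
    have hw : (fun i => (⇑σ)^[ℓ] (w i)) = w := funext fun i => hσiter (w i)
    rw [hΨV_ℓ, hw] at h
    exact h.symm

open Literature.RingTheory.GaloisAlgebras in
/-- **A `σ`-stable similarity class contains a `σ`-fixed matrix.** Let `σ` be an automorphism of
finite order of a field `E` of characteristic `0`, and `U ∈ M_n(E)` a matrix conjugate to its
image `U^σ` under `σ` applied entrywise: `U^σ = x⁻¹ U x`, `x ∈ GL_n(E)`. Then some conjugate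
`g⁻¹ U g`, `g ∈ GL_n(E)`, is fixed by `σ`. Proof: with `y` as in
`exists_mul_map_eq_mul_and_prod_eq_one` (`y U^σ = U y`, twisted norm `1`), Hilbert's Theorem 90
for the algebra `M_n(E)` (`hilbert90_cyclic_of_charZero`) gives a unit `b` with `y b^σ = b`,
and then `(b⁻¹ U b)^σ = b⁻¹ U b`. (Classically: the invariant factors of `U` are `σ`-stable,
hence have coefficients in the fixed field, and `U` is conjugate to their rational canonical
form; Jacobson, *Basic Algebra I*, §3.10; Hungerford, *Algebra*, VII.4.) [folklore] -/
theorem exists_units_conj_map_eq_self [CharZero E] (σ : E ≃+* E) (hσ : IsOfFinOrder σ)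
    (U : Matrix n n E) (x : GL n E)
    (hU : U.map σ = ((x⁻¹ : GL n E) : Matrix n n E) * U * (x : Matrix n n E)) :
    ∃ g : GL n E, (((g⁻¹ : GL n E) : Matrix n n E) * U * (g : Matrix n n E)).map σ =
      ((g⁻¹ : GL n E) : Matrix n n E) * U * (g : Matrix n n E) := by
  obtain ⟨y, hyU, hN⟩ := exists_mul_map_eq_mul_and_prod_eq_one σ U x hU
  let τ : Matrix n n E →+* Matrix n n E := (σ : E →+* E).mapMatrix
  have hτ : ∀ M : Matrix n n E, τ M = M.map σ := fun _ => rfl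
  have hτ_smul : ∀ (c : E) (M : Matrix n n E), τ (c • M) = σ c • τ M := fun c M => by
    ext i j
    simp [hτ]
  have hτℓ : τ ^ orderOf σ = 1 := by
    refine RingHom.ext fun M => ?_
    rw [mapMatrix_pow_apply, RingHom.one_def, RingHom.id_apply]
    change M.map (⇑σ)^[orderOf σ] = M
    rw [← RingAut.coe_pow, pow_orderOf_eq_one, RingAut.coe_one, Matrix.map_id]
  obtain ⟨b, ⟨B, rfl⟩, hyb⟩ :=
    hilbert90_cyclic_of_charZero (R := Matrix n n E) σ hσ τ hτ_smul hτℓ (z := y) hN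
  refine ⟨B, ?_⟩
  have hBB : τ (B : Matrix n n E) * τ ((B⁻¹ : GL n E) : Matrix n n E) = 1 := by
    rw [← map_mul, Units.mul_inv, map_one]
  have key : (B : Matrix n n E) * τ (((B⁻¹ : GL n E) : Matrix n n E) * U * (B : Matrix n n E)) =
      U * B := by
    calc (B : Matrix n n E) * τ (((B⁻¹ : GL n E) : Matrix n n E) * U * (B : Matrix n n E))
        = y * (τ (B : Matrix n n E) * τ ((B⁻¹ : GL n E) : Matrix n n E)) * τ U *
            τ (B : Matrix n n E) := by
          rw [map_mul, map_mul]
          nth_rewrite 1 [← hyb]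
          simp only [mul_assoc]
      _ = y * U.map σ * τ (B : Matrix n n E) := by rw [hBB, mul_one, hτ U]
      _ = U * (y * τ (B : Matrix n n E)) := by rw [hyU, mul_assoc]
      _ = U * B := by rw [hyb]
  rw [← hτ]
  calc τ (((B⁻¹ : GL n E) : Matrix n n E) * U * (B : Matrix n n E))
      = ((B⁻¹ : GL n E) : Matrix n n E) * ((B : Matrix n n E) *
          τ (((B⁻¹ : GL n E) : Matrix n n E) * U * (B : Matrix n n E))) := by
        rw [Units.inv_mul_cancel_left]
    _ = ((B⁻¹ : GL n E) : Matrix n n E) * U * (B : Matrix n n E) := by rw [key, mul_assoc]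

end Descent

section Galois

variable {F E : Type*} [Field F] [Field E] [Algebra F E] {n : Type*} [Fintype n] [DecidableEq n]

/-- **A Galois-stable similarity class contains a rational matrix.** Let `E / F` be a finite
Galois extension of fields of characteristic `0` whose Galois group is generated by `σ` (e.g.
`E / F` cyclic), and `U ∈ M_n(E)` with `U^σ = x⁻¹ U x` for some `x ∈ GL_n(E)`. Then `U` is
`GL_n(E)`-conjugate to a matrix with entries in `F`. (Langlands, *Base change for GL(2)*, §4;
Arthur–Clozel (1989), Ch. 1, proof of Lemma 1.1: "read off the elementary divisors".) [folklore] -/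
theorem exists_units_conj_eq_map_algebraMap [CharZero E] [FiniteDimensional F E] [IsGalois F E]
    (σ : E ≃ₐ[F] E) (hσ : ∀ τ : E ≃ₐ[F] E, τ ∈ Subgroup.zpowers σ) (U : Matrix n n E)
    (x : GL n E) (hU : U.map σ = ((x⁻¹ : GL n E) : Matrix n n E) * U * (x : Matrix n n E)) :
    ∃ (g : GL n E) (Y : Matrix n n F),
      ((g⁻¹ : GL n E) : Matrix n n E) * U * (g : Matrix n n E) = Y.map (algebraMap F E) := by
  -- `σ` as a ring automorphism of finite order
  let ι : (E ≃ₐ[F] E) →* (E ≃+* E) :=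
    { toFun := fun s => (s : E ≃+* E)
      map_one' := rfl
      map_mul' := fun _ _ => rfl }
  have hfin : IsOfFinOrder (ι σ) := ι.isOfFinOrder (isOfFinOrder_of_finite σ)
  obtain ⟨g, hg⟩ := exists_units_conj_map_eq_self (ι σ) hfin U x hU
  -- the entries of `g⁻¹ U g` are fixed by `σ`, hence by `Gal(E/F) = ⟨σ⟩`, hence lie in `F`
  set Y' := ((g⁻¹ : GL n E) : Matrix n n E) * U * (g : Matrix n n E) with hY'
  have hfix : ∀ i j (τ : E ≃ₐ[F] E), τ (Y' i j) = Y' i j := by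
    intro i j τ
    have hσij : σ (Y' i j) = Y' i j := by
      have h := congrArg (fun M : Matrix n n E => M i j) hg
      simp only [Matrix.map_apply] at h
      exact h
    obtain ⟨k, rfl⟩ := Subgroup.mem_zpowers_iff.mp (hσ τ)
    have hnat : ∀ m : ℕ, (σ ^ m) (Y' i j) = Y' i j := fun m => by
      induction m with
      | zero => rfl
      | succ m ih => rw [pow_succ, AlgEquiv.mul_apply, hσij, ih]
    rcases Int.eq_nat_or_neg k with ⟨m, rfl | rfl⟩
    · rw [zpow_natCast, hnat]
    · rw [zpow_neg, zpow_natCast]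
      calc (σ ^ m)⁻¹ (Y' i j) = (σ ^ m)⁻¹ ((σ ^ m) (Y' i j)) := by rw [hnat]
        _ = Y' i j := by rw [← AlgEquiv.mul_apply, inv_mul_cancel, AlgEquiv.one_apply]
  have hmem : ∀ i j, Y' i j ∈ Set.range (algebraMap F E) := fun i j =>
    (IsGalois.mem_range_algebraMap_iff_fixed (Y' i j)).mpr (hfix i j)
  choose Yf hYf using hmem
  refine ⟨g, Matrix.of fun i j => Yf i j, ?_⟩
  ext i j
  rw [Matrix.map_apply, Matrix.of_apply, hYf]

/-- The same for an invertible `U`: a Galois-stable conjugacy class of `GL_n(E)` meets `GL_n(F)`.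
[folklore] -/
theorem exists_units_conj_eq_map_algebraMap_units [CharZero E] [FiniteDimensional F E]
    [IsGalois F E] (σ : E ≃ₐ[F] E) (hσ : ∀ τ : E ≃ₐ[F] E, τ ∈ Subgroup.zpowers σ) (u : GL n E)
    (x : GL n E)
    (hu : (u : Matrix n n E).map σ = ((x⁻¹ : GL n E) : Matrix n n E) * u * (x : Matrix n n E)) :
    ∃ (g : GL n E) (y : GL n F), g⁻¹ * u * g = y.map (algebraMap F E) := by
  obtain ⟨g, Y, hY⟩ := exists_units_conj_eq_map_algebraMap σ hσ (u : Matrix n n E) x hu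
  have hdet : Y.det ≠ 0 := by
    intro h0
    have h1 : (Y.map (algebraMap F E)).det = 0 := by
      rw [← RingHom.mapMatrix_apply, ← RingHom.map_det, h0, map_zero]
    rw [← hY, ← Units.val_mul, ← Units.val_mul] at h1
    exact (Matrix.isUnit_iff_isUnit_det _ |>.mp (Units.isUnit _)).ne_zero h1
  refine ⟨g, Matrix.GeneralLinearGroup.mkOfDetNeZero Y hdet, Units.ext ?_⟩
  rw [Units.val_mul, Units.val_mul, hY]
  rfl

end Galois

end Literature.LinearAlgebra.Matrix
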